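import Summits.ResolutionOfSingularities.ResolutionOfSingularities.Theorems.FrobeniusLadderFInjectiveMacaulayficationCIChartClause
import Summits.ResolutionOfSingularities.ResolutionOfSingularities.Theorems.FrobeniusLadderFInjectiveMacaulayficationCICodimTwoCM
import Summits.ResolutionOfSingularities.ResolutionOfSingularities.Theorems.FrobeniusLadderFInjectiveMacaulayficationCIExpectedDim
import Summits.ResolutionOfSingularities.ResolutionOfSingularities.Theorems.FrobeniusLadderFInjectiveMacaulayficationWFixAtNonClosedDimTwo
import Summits.ResolutionOfSingularities.ResolutionOfSingularities.Theorems.FrobeniusLadderFInjectiveMacaulayficationPencilFedder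
import Literature.AlgebraicGeometry.Resolution.AffineDomainEquidim
import HarnessLib

/-!
# BED Ω ROW ENGINE, FULL direction: a codimension-2 complete intersection `k[Y]/(g₁, g₂)` is FULL at a closed point OFF THE DEEP LOCUS — the twin of ✓p689316 `PencilFedder`
# (crux `FInjectiveMacaulayfication` stmt-ResolutionOfSingularities-15315, chain w45a; SEAT TABLE v35.0 «stub-1 g14 … ON CALL (FULL-direction pencil lemma off the deep locus)»;
# seat res-L1-w45a-stub-1 g14)

[OURS · L1 W4.5a] Support file (`--supports stmt-ResolutionOfSingularities-15315 --as helper`); theorems only; unconditional; ANY field of characteristic `p`. Glue over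
res-L1-w45a-stub-6's CI Fedder clause ✓ `CIChartClause.ci_fedderAtMaximalIdeal_of_eq` and stub-1 g10's ✓ `CICodimTwoCM`; nothing of the crux is proved; no census row is asserted.
AI-written (AI review is weaker than expert review).

WHAT IT IS FOR. The `W`-chart of the blowing up of a hypersurface `X = V(G)` along a pencil `Ω = (M, B)` is the codimension-2 complete intersection `k[Y]/(G, M·Y_w − B)` (when that
ideal is prime and misses `M`, the `M`-saturation is trivial). ✓p689316 gives its CM clause everywhere (`pencilChart_cmCl`) and NOT-FULLness at the deep fibre points; this file gives
FULLness at every closed point carrying a Fedder certificate `(G·(M·Y_w − B))^{p−1} ∉ 𝔪_y^{[p]}` — the points OFF the deep locus — so that a second-storey centre cosupported over the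
deep locus suffices (the Ω₁ kernel row of the next generation, stub-3 TASK 4 / tri-2).
* §1 `isWeaklyRegular_pair` — `[g₁, g₂]` is a weakly regular sequence on `k[Y]_P` (`g₁` prime, `g₁ ∤ g₂`, `g₁, g₂ ∈ P`); ★ `ringKrullDim_localization_add_two` — EXPECTED DIMENSION
  `dim (k[Y]/(g₁, g₂))_Q + 2 = m` at every MAXIMAL `Q` (Krull: maximal ideals of `k[Y₁..Y_m]` have height `m`, ✓ Literature `MvPolynomial.height_eq_of_isMaximal`; cut down by the
  regular sequence, ✓ `CIExpectedDim`).
* §2 ★★ `ci2_fullCl_stalk_of_fedder` — `(g₁, g₂)` prime, `y` a closed point with `𝔪_y ∩ k[Y] = (a₁, …, a_{m′})`, `(g₁g₂)^{p−1} ∉ (aᵢ^p)` ⇒ `FullCl p 𝒪_{V(g₁,g₂), y}` (domain ∧ CM ∧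
  Frobenius-closed parameter ideals; [cite: Fedder1983, Prop. 1.7, Thm. 1.12 and Prop. 2.1] through stub-6's clause).
* §3 ★ `pencilChart_fullCl_at` — the pencil specialisation `g₁ = G`, `g₂ = M·Y_w − B` with `G, M, B` free of `Y_w`, `G` prime, `G ∤ M` (so `G ∤ M·Y_w − B`, ✓ `PencilFedder`).
WHAT IT DOES NOT SAY: which points carry the certificate (per bed, by kit, as for every census row), nor primality of `(G, M·Y_w − B)` (a per-row hypothesis `hprime`).
-/

set_option linter.dupNamespace false

noncomputable section

open AlgebraicGeometry IsLocalRing RingTheory.Sequence Literature.AlgebraicGeometry.Resolution MvPolynomial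
open scoped Pointwise

namespace Summit.ResolutionOfSingularities.ResolutionOfSingularities.Theorems.FInjectiveMacaulayfication.PencilFedderFull

open Summit.ResolutionOfSingularities.ResolutionOfSingularities.Theorems.FInjectiveMacaulayfication
open SliceableCentre TauFloorOneCIChartCM

variable (k : Type) [Field k]

/-! ## §1 The regular sequence and the expected dimension -/

/-- **`[g₁, g₂]` is weakly regular on `k[Y]_P`** for `g₁` prime, `g₁ ∤ g₂` and `P` a prime containing `g₁` (so that `(g₁)k[Y]_P` is a prime not containing `g₂`). [folklore;
cite: Matsumura1987, Thm. 17.4] -/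
theorem isWeaklyRegular_pair {m : ℕ} (g₁ g₂ : MvPolynomial (Fin m) k) (hg₁ : Prime g₁) (hg₂ : ¬ g₁ ∣ g₂)
    (P : Ideal (MvPolynomial (Fin m) k)) [P.IsPrime] (hg₁P : g₁ ∈ P) :
    IsWeaklyRegular (Localization.AtPrime P)
      [algebraMap (MvPolynomial (Fin m) k) (Localization.AtPrime P) g₁, algebraMap (MvPolynomial (Fin m) k) (Localization.AtPrime P) g₂] := by
  classical
  set Rp := Localization.AtPrime P with hRp
  set alg : MvPolynomial (Fin m) k →+* Rp := algebraMap (MvPolynomial (Fin m) k) Rp with halg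
  haveI : IsRegularLocalRing Rp := IsRegularRing.isRegularLocalRing_localization P
  haveI : IsDomain Rp := isDomain_of_isRegularLocalRing Rp
  have hinj : Function.Injective alg := IsLocalization.injective Rp P.primeCompl_le_nonZeroDivisors
  have ha₁0 : alg g₁ ≠ 0 := fun h => hg₁.ne_zero (hinj (by rw [h, map_zero]))
  -- `(g₁)Rp` is prime and misses `g₂`
  have hdisj : Disjoint (P.primeCompl : Set (MvPolynomial (Fin m) k)) (Ideal.span {g₁} : Ideal (MvPolynomial (Fin m) k)) := by
    refine Set.disjoint_left.mpr fun x hx hxI => hx ?_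
    exact (Ideal.span_singleton_le_iff_mem _ |>.mpr hg₁P) hxI
  have hprime1 : (Ideal.span {alg g₁} : Ideal Rp).IsPrime := by
    have h := IsLocalization.isPrime_of_isPrime_disjoint P.primeCompl Rp (Ideal.span {g₁})
      ((Ideal.span_singleton_prime hg₁.ne_zero).mpr hg₁) hdisj
    rwa [Ideal.map_span, Set.image_singleton] at h
  have ha₂not : alg g₂ ∉ (Ideal.span {alg g₁} : Ideal Rp) := by
    intro hmem
    have hcomap := IsLocalization.under_map_of_isPrime_disjoint P.primeCompl Rp
      ((Ideal.span_singleton_prime hg₁.ne_zero).mpr hg₁) hdisj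
    have : g₂ ∈ (Ideal.map alg (Ideal.span {g₁})).under (MvPolynomial (Fin m) k) := by
      rw [Ideal.under_def, Ideal.mem_comap, Ideal.map_span, Set.image_singleton]; exact hmem
    rw [hcomap, Ideal.mem_span_singleton] at this
    exact hg₂ this
  have hcolon : ∀ v : Rp, v * alg g₂ ∈ (Ideal.span {alg g₁} : Ideal Rp) → v ∈ (Ideal.span {alg g₁} : Ideal Rp) :=
    fun v hv => ((hprime1.mem_or_mem hv).resolve_right ha₂not)
  have hreg2 : IsSMulRegular (QuotSMulTop (alg g₁) Rp) (alg g₂) := by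
    have heq : ((alg g₁) • (⊤ : Submodule Rp Rp)) = (Ideal.span {alg g₁} : Ideal Rp) := by
      rw [← Submodule.ideal_span_singleton_smul, smul_eq_mul, Ideal.mul_top]
    change IsSMulRegular (Rp ⧸ ((alg g₁) • (⊤ : Submodule Rp Rp))) (alg g₂)
    rw [heq]
    intro b c hbc
    obtain ⟨b, rfl⟩ := Ideal.Quotient.mk_surjective b
    obtain ⟨c, rfl⟩ := Ideal.Quotient.mk_surjective c
    have hbc' : Ideal.Quotient.mk (Ideal.span {alg g₁}) (alg g₂ * b) = Ideal.Quotient.mk (Ideal.span {alg g₁}) (alg g₂ * c) := by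
      change Ideal.Quotient.mk (Ideal.span {alg g₁}) (alg g₂ • b) = Ideal.Quotient.mk (Ideal.span {alg g₁}) (alg g₂ • c) at hbc
      simpa only [smul_eq_mul] using hbc
    rw [Ideal.Quotient.eq] at hbc' ⊢
    rw [← mul_sub] at hbc'
    exact hcolon _ (by rw [mul_comm]; exact hbc')
  have hreg1 : IsSMulRegular Rp (alg g₁) := (IsRegular.of_ne_zero ha₁0).left.isSMulRegular
  exact (isWeaklyRegular_cons_iff Rp _ _).2 ⟨hreg1, (isWeaklyRegular_cons_iff _ _ _).2 ⟨hreg2, IsWeaklyRegular.nil _ _⟩⟩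

/-- ★ **EXPECTED DIMENSION of a codimension-2 complete intersection at a closed point**: `dim (k[Y₁..Y_m]/(g₁, g₂))_Q + 2 = m` for `g₁` prime, `g₁ ∤ g₂` and `Q` MAXIMAL.
[folklore; cite: Matsumura1987, Thm. 17.4 and §5 Ex. 5.1] -/
theorem ringKrullDim_localization_add_two {m : ℕ} (g₁ g₂ : MvPolynomial (Fin m) k) (hg₁ : Prime g₁) (hg₂ : ¬ g₁ ∣ g₂)
    (Q : Ideal (MvPolynomial (Fin m) k ⧸ Ideal.span {g₁, g₂})) [Q.IsMaximal] :
    ringKrullDim (Localization.AtPrime Q) + (2 : WithBot ℕ∞) = (m : WithBot ℕ∞) := by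
  classical
  set P : Ideal (MvPolynomial (Fin m) k) := Q.comap (Ideal.Quotient.mk (Ideal.span {g₁, g₂})) with hPdef
  haveI hPmax : P.IsMaximal := Ideal.comap_isMaximal_of_surjective _ Ideal.Quotient.mk_surjective
  set Rp := Localization.AtPrime P with hRp
  set alg : MvPolynomial (Fin m) k →+* Rp := algebraMap (MvPolynomial (Fin m) k) Rp with halg
  have hgI : g₁ ∈ Ideal.span {g₁, g₂} ∧ g₂ ∈ Ideal.span {g₁, g₂} := ⟨Ideal.subset_span (Or.inl rfl), Ideal.subset_span (Or.inr rfl)⟩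
  have hg₁P : g₁ ∈ P := by
    rw [hPdef, Ideal.mem_comap, Ideal.Quotient.eq_zero_iff_mem.mpr hgI.1]; exact Q.zero_mem
  have hg₂P : g₂ ∈ P := by
    rw [hPdef, Ideal.mem_comap, Ideal.Quotient.eq_zero_iff_mem.mpr hgI.2]; exact Q.zero_mem
  have hmax : maximalIdeal Rp = P.map alg := (Localization.AtPrime.map_eq_maximalIdeal (I := P)).symm
  -- `dim Rp = m`
  have hdimRp : ringKrullDim Rp = (m : WithBot ℕ∞) := by
    rw [IsLocalization.AtPrime.ringKrullDim_eq_height P Rp, MvPolynomial.height_eq_of_isMaximal k m P]; norm_cast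
  -- cut down by the regular sequence `[g₁, g₂]`
  have hcut := CIExpectedDim.ringKrullDim_quotient_ofList_add_length 2 Rp [alg g₁, alg g₂] rfl (by
    intro x hx
    simp only [List.mem_cons, List.not_mem_nil, or_false] at hx
    rcases hx with rfl | rfl
    · rw [hmax]; exact Ideal.mem_map_of_mem _ hg₁P
    · rw [hmax]; exact Ideal.mem_map_of_mem _ hg₂P) (isWeaklyRegular_pair k g₁ g₂ hg₁ hg₂ P hg₁P)
  -- transport `Rp ⧸ (g₁, g₂) ≅ (k[Y]/(g₁, g₂))_Q`
  have h2 : Ideal.ofList [alg g₁, alg g₂] = (Ideal.span {g₁, g₂}).map alg := by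
    rw [Ideal.map_span alg {g₁, g₂}, Set.image_pair]
    change Ideal.span {x | x ∈ [alg g₁, alg g₂]} = _
    congr 1
    ext x; simp
  obtain ⟨eI⟩ := exists_quotLocalizationEquiv (Ideal.span {g₁, g₂}) Q
  have hdq : ringKrullDim (Rp ⧸ Ideal.ofList [alg g₁, alg g₂]) = ringKrullDim (Localization.AtPrime Q) :=
    ringKrullDim_eq_of_ringEquiv ((Ideal.quotEquivOfEq h2).trans eI)
  rw [hdq] at hcut
  rw [← hdimRp, ← hcut]
  norm_cast

/-! ## §2 ★★ FULL at a certified closed point -/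

/-- ★★ **A CODIMENSION-2 COMPLETE INTERSECTION IS FULL AT A CLOSED POINT CARRYING A FEDDER CERTIFICATE**: `g₁` prime, `g₁ ∤ g₂`, `(g₁, g₂)` prime; `y` a closed point of
`V(g₁, g₂) ⊂ 𝔸^m` whose maximal ideal contracts to `(a₁, …, a_{m′}) ⊂ k[Y]`; `(g₁·g₂)^{p−1} ∉ (a₁^p, …, a_{m′}^p)`. Then `𝒪_{V(g₁,g₂), y}` is `FullCl p` (a domain whose systems of
parameters are weakly regular with Frobenius-closed ideals). [cite: Fedder1983, Prop. 1.7, Thm. 1.12 and Prop. 2.1] -/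
theorem ci2_fullCl_stalk_of_fedder (p : ℕ) [Fact p.Prime] [CharP k p] {m m' : ℕ} (g₁ g₂ : MvPolynomial (Fin m) k) (hg₁ : Prime g₁) (hg₂ : ¬ g₁ ∣ g₂)
    (hprime : (Ideal.span {g₁, g₂} : Ideal (MvPolynomial (Fin m) k)).IsPrime) (a : Fin m' → MvPolynomial (Fin m) k)
    (y : Spec (.of (MvPolynomial (Fin m) k ⧸ Ideal.span {g₁, g₂}))) (hy : y.asIdeal.IsMaximal)
    (ha : y.asIdeal.comap (Ideal.Quotient.mk (Ideal.span {g₁, g₂})) = Ideal.span (Set.range a))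
    (hfed : (g₁ * g₂) ^ (p - 1) ∉ Ideal.span (Set.range fun i : Fin m' => a i ^ p)) :
    FullCl p ((Spec (.of (MvPolynomial (Fin m) k ⧸ Ideal.span {g₁, g₂}))).presheaf.stalk y) := by
  haveI := hprime
  haveI : IsDomain (MvPolynomial (Fin m) k ⧸ Ideal.span {g₁, g₂}) := Ideal.Quotient.isDomain _
  haveI := hy
  haveI : IsDomain (Localization.AtPrime y.asIdeal) :=
    IsLocalization.isDomain_of_le_nonZeroDivisors _ y.asIdeal.primeCompl_le_nonZeroDivisors
  have hofList : Ideal.ofList [g₁, g₂] = (Ideal.span {g₁, g₂} : Ideal (MvPolynomial (Fin m) k)) := by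
    change Ideal.span {x | x ∈ [g₁, g₂]} = _
    congr 1
    ext x; simp
  have hfed' : [g₁, g₂].prod ^ (p - 1) ∉ Ideal.span (Set.range fun i : Fin m' => a i ^ p) := by
    simpa only [List.prod_cons, List.prod_nil, mul_one] using hfed
  have hdim : ringKrullDim (Localization.AtPrime y.asIdeal) + ([g₁, g₂].length : WithBot ℕ∞) = (m : WithBot ℕ∞) := by
    simpa using ringKrullDim_localization_add_two k g₁ g₂ hg₁ hg₂ y.asIdeal
  have hloc : FullCl p (Localization.AtPrime y.asIdeal) :=
    ⟨inferInstance, CIChartClause.ci_fedderAtMaximalIdeal_of_eq p k m m' a [g₁, g₂] (Ideal.span {g₁, g₂}) hofList y.asIdeal ha hfed' hdim⟩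
  exact WFixAtNonClosedDimTwo.fullCl_of_ringEquiv p (Spec.stalkIso (.of _) y).commRingCatIsoToRingEquiv.symm hloc

/-! ## §3 ★ The pencil chart -/

/-- ★ **THE PENCIL CHART `k[Y]/(G, M·Y_w − B)` IS FULL AT EVERY CERTIFIED CLOSED POINT**: `G` prime, `G, M, B` free of `Y_w`, `G ∤ M`, the chart ideal prime; at a closed point `y`
with `𝔪_y ∩ k[Y] = (a₁, …, a_{m′})` and `(G·(M·Y_w − B))^{p−1} ∉ (aᵢ^p)`, the stalk is `FullCl p`. With ✓p689316 `pencilChart_cmCl` / `pencilChart_not_full_at` this is the two-sided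
point-wise FULLness ledger of the pencil chart. [cite: Fedder1983, Thm. 1.12] -/
theorem pencilChart_fullCl_at (p : ℕ) [Fact p.Prime] [CharP k p] {m m' : ℕ} (w : Fin m) (G M B : MvPolynomial (Fin m) k) (hG : Prime G)
    (hGw : pderiv w G = 0) (hMw : pderiv w M = 0) (hBw : pderiv w B = 0) (hGM : ¬ G ∣ M)
    (hprime : (Ideal.span {G, M * X w - B} : Ideal (MvPolynomial (Fin m) k)).IsPrime) (a : Fin m' → MvPolynomial (Fin m) k)
    (y : Spec (.of (MvPolynomial (Fin m) k ⧸ Ideal.span {G, M * X w - B}))) (hy : y.asIdeal.IsMaximal)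
    (ha : y.asIdeal.comap (Ideal.Quotient.mk (Ideal.span {G, M * X w - B})) = Ideal.span (Set.range a))
    (hfed : (G * (M * X w - B)) ^ (p - 1) ∉ Ideal.span (Set.range fun i : Fin m' => a i ^ p)) :
    FullCl p ((Spec (.of (MvPolynomial (Fin m) k ⧸ Ideal.span {G, M * X w - B}))).presheaf.stalk y) :=
  ci2_fullCl_stalk_of_fedder k p G (M * X w - B) hG (PencilFedder.not_dvd_pencil_of_not_dvd k w G M B hGw hMw hBw hGM) hprime a y hy ha hfed

end Summit.ResolutionOfSingularities.ResolutionOfSingularities.Theorems.FInjectiveMacaulayfication.PencilFedderFull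

end
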